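import Literature.NumberTheory.EllipticCurves.AtkinLehnerInvolutionsProofs
import Literature.NumberTheory.EllipticCurves.HeegnerPointReflectionProofs
import Literature.NumberTheory.EllipticCurves.BSDRootNumberOddParityProofs
import HarnessLib

/-!
# The Atkin–Lehner involution at `Q = N` IS the Fricke involution, and the rank-`0` Fricke sign
# (proofs over `AtkinLehnerInvolutions` / `CuspFormLFunction`; cell `b2b-bsdres`, team n1011,
# seat p03 gen 6 — r1 ROUTE-1 §30/§31 item R1-55 '`hε ↦ T`')

A `…Proofs` sibling (theorems only: no definition, no named fact, no instance).

`AtkinLehnerInvolutions` defines `atkinLehnerInvolution N k Q = Q^{1−k/2} • [Γ₀(N) w(Q) Γ₀(N)]` for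
the canonical matrix `w(Q) = β(Q) diag(Q, 1)`, `β(Q) = (gcdA Q (N/Q), −gcdB Q (N/Q); N/Q, Q)`, and
`CuspFormLFunction` defines `frickeInvolution N k = N^{1−k/2} • [Γ₀(N) w_N Γ₀(N)]` for
`w_N = (0, −1; N, 0)`.  At `Q = N` these are the SAME operator — Knapp 1993, Lemma 9.24: "`w_Q` is
independent of the choice of defining matrix `w(Q)`"; here concretely
`w(N) = (N·gcdA N 1, −gcdB N 1; N, N) = γ₀ · w_N` with `γ₀ = (gcdB N 1, gcdA N 1; −N, 1) ∈ Γ₀(N)`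
(`det γ₀ = gcdB + N·gcdA = gcd(N, 1) = 1`), so `f ∣[k] w(N) = f ∣[k] w_N` for `f ∈ S_k(Γ₀(N))`:

* `coe_atkinLehnerSL_self` — `β(N) = (gcdA N 1, −gcdB N 1; 1, N)`;
* `glCast_atkinLehnerW_self` — `w(N) = γ₀ · w_N` in `GL(2, ℝ)` with `γ₀ ∈ Γ₀(N)`;
* `atkinLehnerInvolution_self_eq_frickeInvolution` — **`w_Q|_{Q = N} = w_N`** on `S_k(Γ₀(N))`
  (the two one-term formulas `atkinLehnerInvolution_apply_eq_slash`, `frickeInvolution_apply_eq_slash_holds`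
  and `Γ₀(N)`-invariance);
* `atkinLehnerEigenvalue_self_eq_frickeEigenvalue` — hence `λ(N) = ε(f)` for a `w_N`-eigenvector `f ≠ 0`;
* `frickeInvolution_eq_neg_of_entireLFunction_one_ne_zero`,
  `atkinLehnerInvolution_level_eq_neg_of_entireLFunction_one_ne_zero` — **the rank-`0` Fricke sign**:
  for the newform `f` of an elliptic curve `E/ℚ` at level `N_E` with `L(E, 1) ≠ 0`, the root number is
  `+1` (`Λ(E, 1) = −Λ(E, 1)` is impossible: `entireLFunction_one_eq_zero_of_rootNumber_eq_neg_one`),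
  `w(E) = −ε(f)` (`rootNumber_eq_neg_frickeEigenvalue`, Atkin–Lehner Thm. 3 / Hecke), so
  `w_N f = −f` and `w_{Q = N} f = −f`.

USE (cell b2b-bsdres, n1011 records): additive-p4's `kuriharaNumber_eq_zero_of_fricke_sign_of_irreducible`
and r1's ROUTE-1 §27.4 ('`hv` free by parity at `j = 1`') carry the rank-`0` Fricke sign `σ = 1`,
i.e. `w_N f = −f`, as a per-record EVIDENCE binder `hε`; with this file it is a THEOREM on every
rank-`0` pair record whose parametrisation level is the conductor. Nothing booked; no label moved.

References: A. W. Knapp, *Elliptic Curves* (1993), Lemma 9.24 and (9.62) [Knapp1993]; A. O. L. Atkin,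
J. Lehner, Math. Ann. 185 (1970) §2, Thm. 3 [AtkinLehner1970]; H. Darmon, *Rational points on
modular elliptic curves* (2004) (2.13)–(2.17) [Darmon2004]; J. H. Silverman, *AEC* C.16
[SilvermanAEC2009].
-/

noncomputable section

open scoped MatrixGroups ModularForm

open CongruenceSubgroup Matrix.SpecialLinearGroup UpperHalfPlane Complex

namespace Literature.NumberTheory.EllipticCurves.ModularForms

/-! ### `w(N) = γ₀ · w_N` -/

section Matrices

variable (N : ℕ) [NeZero N]

/-- `gcd(N, N/N) = gcd(N, 1) = 1`: `Q = N` is an exact divisor of `N`. [folklore] -/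
private theorem coprime_self_div_self : Nat.Coprime N (N / N) := by
  rw [Nat.div_self (NeZero.pos N)]
  exact Nat.coprime_one_right N

/-- `β(N) = (gcdA N 1, −gcdB N 1; 1, N)` (the defining Bézout matrix of `w(N)` at `Q = N`, where
`N/Q = 1`). [cite: Knapp1993, (9.62)] -/
theorem coe_atkinLehnerSL_self :
    (atkinLehnerSL N N : Matrix (Fin 2) (Fin 2) ℤ) =
      !![Nat.gcdA N 1, -Nat.gcdB N 1; 1, (N : ℤ)] := by
  rw [coe_atkinLehnerSL_of_coprime N N (coprime_self_div_self N), Nat.div_self (NeZero.pos N)]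
  simp

omit [NeZero N] in
/-- The matrix `γ₀ = (gcdB N 1, gcdA N 1; −N, 1) ∈ SL(2, ℤ)` (`det = gcdB + N·gcdA = gcd(N,1) = 1`)
with `w(N) = γ₀ w_N`. [cite: Knapp1993, Lemma 9.24] -/
theorem det_frickeTwist_eq_one :
    Matrix.det !![Nat.gcdB N 1, Nat.gcdA N 1; -(N : ℤ), 1] = 1 := by
  have hb := Nat.gcd_eq_gcd_ab N 1
  rw [Nat.gcd_one_right, Nat.cast_one] at hb
  rw [Matrix.det_fin_two_of]
  linear_combination -hb

omit [NeZero N] in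
/-- `γ₀ = (gcdB N 1, gcdA N 1; −N, 1) ∈ Γ₀(N)` (lower-left entry `−N ≡ 0 (mod N)`). [cite: Knapp1993, Lemma 9.24] -/
theorem frickeTwist_mem_Gamma0 :
    (⟨!![Nat.gcdB N 1, Nat.gcdA N 1; -(N : ℤ), 1], det_frickeTwist_eq_one N⟩ : SL(2, ℤ)) ∈ Gamma0 N :=
  Gamma0_mem.mpr (by simp)

/-- **`w(N) = γ₀ · w_N` in `GL(2, ℝ)`**, `γ₀ = (gcdB N 1, gcdA N 1; −N, 1) ∈ Γ₀(N)`: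
`w(N) = β(N) diag(N, 1) = (N·gcdA N 1, −gcdB N 1; N, N)` and
`γ₀ · (0, −1; N, 0) = (N·gcdA N 1, −gcdB N 1; N, N)` (Knapp 1993, Lemma 9.24: the operator `w_Q` does
not depend on the representative of the coset `Γ₀(N) w(Q)`; at `Q = N` the Fricke matrix is one).
[cite: Knapp1993, Lemma 9.24] -/
theorem glCast_atkinLehnerW_self :
    glCast (atkinLehnerW N N : GL (Fin 2) ℚ) =
      mapGL ℝ (⟨!![Nat.gcdB N 1, Nat.gcdA N 1; -(N : ℤ), 1], det_frickeTwist_eq_one N⟩ : SL(2, ℤ)) *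
        glCast (frickeGL N : GL (Fin 2) ℚ) := by
  apply Units.ext
  rw [glCast_atkinLehnerW, Units.val_mul, Units.val_mul, val_mapGL', val_mapGL', val_tpD,
    val_glCast_frickeGL, coe_atkinLehnerSL_self]
  ext i j
  fin_cases i <;> fin_cases j <;>
    simp [Matrix.mul_apply, Fin.sum_univ_two, Matrix.map_apply, mul_comm]

end Matrices

/-! ### `w_{Q = N} = w_N` -/

section Involution

variable (N : ℕ) [NeZero N] (k : ℤ)

/-- **The Atkin–Lehner involution at `Q = N` is the Fricke involution**: `w_{Q=N} f = w_N f` for every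
`f ∈ S_k(Γ₀(N))` — both are `N^{1−k/2} • (f ∣[k] ·)` of matrices in the same coset `Γ₀(N) w_N`
(`glCast_atkinLehnerW_self`) and `f` is `Γ₀(N)`-invariant (Knapp 1993, Lemma 9.24: "`w_Q` … is
independent of the choice of defining matrix `w(Q)`"). [cite: Knapp1993, Lemma 9.24] -/
theorem atkinLehnerInvolution_self_eq_frickeInvolution (f : CuspForm (Gamma0 N) k) :
    atkinLehnerInvolution N k N f = frickeInvolution N k f := by
  apply DFunLike.coe_injective
  rw [atkinLehnerInvolution_apply_eq_slash N k N (dvd_refl N) (coprime_self_div_self N) f,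
    frickeInvolution_apply_eq_slash_holds N k f, glCast_atkinLehnerW_self N, SlashAction.slash_mul,
    SlashInvariantFormClass.slash_action_eq f (mapGL ℝ _)
      (Subgroup.mem_map_of_mem _ (frickeTwist_mem_Gamma0 N))]

/-- As linear maps: `atkinLehnerInvolution N k N = frickeInvolution N k`. [cite: Knapp1993, Lemma 9.24] -/
theorem atkinLehnerInvolution_self_eq_frickeInvolution' :
    atkinLehnerInvolution N k N = frickeInvolution N k :=
  LinearMap.ext (atkinLehnerInvolution_self_eq_frickeInvolution N k)

variable {N k}

/-- **`λ(N) = ε(f)`**: for a `w_N`-eigenvector `f ≠ 0`, the Atkin–Lehner eigenvalue at `Q = N`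
equals the Fricke eigenvalue. [cite: Knapp1993, Thm. 9.27] [cite: AtkinLehner1970, Thm. 3] -/
theorem atkinLehnerEigenvalue_self_eq_frickeEigenvalue {f : CuspForm (Gamma0 N) k} (hf : f ≠ 0)
    (h : ∃ ε : ℂ, frickeInvolution N k f = ε • f) :
    atkinLehnerEigenvalue f N = frickeEigenvalue f := by
  apply atkinLehnerEigenvalue_eq_of_eq_smul N hf
  rw [atkinLehnerInvolution_self_eq_frickeInvolution]
  exact frickeInvolution_eq_frickeEigenvalue_smul h

end Involution

end Literature.NumberTheory.EllipticCurves.ModularForms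

/-! ### The rank-`0` Fricke sign -/

namespace Literature.NumberTheory.EllipticCurves

open ModularForms

variable {W : WeierstrassCurve ℚ}

/-- **`L(E,1) ≠ 0 ⟹ w(E) = +1`**: a functional equation with sign `−1` forces `Λ(E,1) = 0`
(Silverman *AEC* C.16, remark after Thm. 16.3). [cite: SilvermanAEC2009, C.16 Thm. 16.3 and remark, p. 451] -/
theorem rootNumber_eq_one_of_entireLFunction_one_ne_zero [W.IsElliptic]
    (hL : W.entireLFunction 1 ≠ 0) : W.rootNumber = 1 := by
  rcases rootNumber_eq_one_or_eq_neg_one W with h | h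
  · exact h
  · exact absurd (WeierstrassCurve.entireLFunction_one_eq_zero_of_rootNumber_eq_neg_one h) hL

/-- **The rank-`0` Fricke sign**: for the newform `f` of an elliptic `E/ℚ` at level `N_E` with
`L(E, 1) ≠ 0`, `w_N f = −f` (`w(E) = −ε(f)` by Hecke's functional equation and Atkin–Lehner Thm. 3,
`rootNumber_eq_neg_frickeEigenvalue`; `w(E) = +1` since `L(E,1) ≠ 0`). [cite: AtkinLehner1970, Thm. 3]
[cite: Darmon2004, (2.13)–(2.14) and (2.17)] -/
theorem frickeInvolution_eq_neg_of_entireLFunction_one_ne_zero [W.IsElliptic]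
    [NeZero (W.conductorNorm ℤ)] {f : CuspForm (Gamma0 (W.conductorNorm ℤ)) 2}
    (hf : IsNewformOf W f) (hL : W.entireLFunction 1 ≠ 0) :
    frickeInvolution (W.conductorNorm ℤ) 2 f = (-(1 : ℂ)) • f := by
  have hw := rootNumber_eq_neg_frickeEigenvalue
    (fun N _ => IsNewform0.exists_functional_equation_holds (N := N) (k := (2 : ℤ)))
    (fun N _ => IsNewform0.frickeEigenvalue_eq_one_or_eq_neg_one_holds (N := N) (k := (2 : ℤ))) hf
  rw [rootNumber_eq_one_of_entireLFunction_one_ne_zero hL] at hw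
  have hε : frickeEigenvalue f = -1 := by
    have : (1 : ℂ) = -frickeEigenvalue f := by exact_mod_cast hw
    linear_combination this
  obtain ⟨ε, -, hεf⟩ := IsNewform0.exists_frickeInvolution_eq_smul_holds hf.1
  rw [frickeInvolution_eq_frickeEigenvalue_smul ⟨ε, hεf⟩, hε]

/-- **R1-55 (`hε ↦ T`)**: for the newform `f` of an elliptic `E/ℚ` at level `N_E` with `L(E, 1) ≠ 0`,
the Atkin–Lehner involution at `Q = N_E` acts by `−1`: `w_{N_E} f = −f` — the rank-`0` Fricke sign
`σ = 1` of the cell's Kurihara-number records (additive-p4's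
`kuriharaNumber_eq_zero_of_fricke_sign_of_irreducible`, r1 ROUTE-1 §27.4) as a THEOREM.
[cite: Knapp1993, Lemma 9.24 and Thm. 9.27] [cite: AtkinLehner1970, Thm. 3] -/
theorem atkinLehnerInvolution_level_eq_neg_of_entireLFunction_one_ne_zero [W.IsElliptic]
    [NeZero (W.conductorNorm ℤ)] {f : CuspForm (Gamma0 (W.conductorNorm ℤ)) 2}
    (hf : IsNewformOf W f) (hL : W.entireLFunction 1 ≠ 0) :
    atkinLehnerInvolution (W.conductorNorm ℤ) 2 (W.conductorNorm ℤ) f = (-(1 : ℂ)) • f := by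
  rw [atkinLehnerInvolution_self_eq_frickeInvolution]
  exact frickeInvolution_eq_neg_of_entireLFunction_one_ne_zero hf hL

/-- The same with the eigenvalue: `λ(N_E) = −1` for the newform of a rank-`0` (`L(E,1) ≠ 0`) curve.
[cite: Knapp1993, Thm. 9.27] [cite: AtkinLehner1970, Thm. 3] -/
theorem atkinLehnerEigenvalue_level_eq_neg_one_of_entireLFunction_one_ne_zero [W.IsElliptic]
    [NeZero (W.conductorNorm ℤ)] {f : CuspForm (Gamma0 (W.conductorNorm ℤ)) 2}
    (hf : IsNewformOf W f) (hL : W.entireLFunction 1 ≠ 0) :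
    atkinLehnerEigenvalue f (W.conductorNorm ℤ) = -1 := by
  have hf0 : f ≠ 0 := hf.1.ne_zero
  exact atkinLehnerEigenvalue_eq_of_eq_smul (W.conductorNorm ℤ) hf0
    (atkinLehnerInvolution_level_eq_neg_of_entireLFunction_one_ne_zero hf hL)

end Literature.NumberTheory.EllipticCurves

end
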